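import Literature.NumberTheory.IwasawaTheory.NarrowFukudaRankProofs
import Literature.NumberTheory.IwasawaTheory.CyclotomicTwoTotallyRamifiedOddIndex
import HarnessLib

/-!
# NARROW FUKUDA — concrete layer models for the narrow rank certificate at `n₀ = 0`: `K_0 ≅ K`, `K_1 ≅ K(√2)` for every cyclotomic
# `ℤ₂`-extension of an odd-degree number field `K`, so that the certificate reads «`rank₂ Cl⁺(K(√2)) = rank₂ Cl⁺(K)`»

Topic `NumberTheory/IwasawaTheory` (namespace = path). THEOREM-ONLY file (no definition, no named fact, no `sorry`), written by the prover seat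
`cruxlead-stmt-BirchSwinnertonDyer-19573-w2` GEN 9 (cell `bsd-2adic`; `--supports` stmt-BirchSwinnertonDyer-19573; closes nothing). Companion of
`NarrowFukudaRankProofs.NarrowFukuda.narrowMu_of_narrowRankCertificate`, whose certificate is phrased for the abstract layers `κ.layer m` of EVERY
cyclotomic `ℤ₂`-extension `κ` of `K`.  For an odd-degree `K` (e.g. the cubic point fields of the BSD cell) the first two layers have canonical models:
`K_0 = K` (`ZpExtension.layer_zero`) and `K_1 = K(√2)` (Washington §13.1: `ℚ_1 = ℚ(√2)`; tree `exists_sq_eq_two_layer_one_of_not_dvd_finrank`), and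
any two quadratic extensions of `K` generated by a square root of `2` are `K`-isomorphic (`X² − 2` is irreducible over an odd-degree `K`).  With the
transport `index_range_pow_narrowClassGroup_eq_of_ringEquiv` the `n₀ = 0` certificate becomes a statement about two concrete fields.

* §1 `sq_ne_two_of_odd_finrank` (`√2 ∉ K` for `[K:ℚ]` odd), `irreducible_X_sq_sub_two_of_odd_finrank`, `nonempty_algEquiv_of_sq_eq_two_of_odd_finrank`
  (two quadratic extensions of `K` containing a square root of `2` are `K`-isomorphic).
* §2 `nonempty_algEquiv_layer_zero` (`K_0 ≃ₐ[K] K`, any `ℤ_p`-extension), `nonempty_algEquiv_layer_one_of_sq_eq_two` (`K_1 ≃ₐ[K] L` for every quadratic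
  `L/K` with `θ² = 2`, every cyclotomic `ℤ₂`-extension, `[K:ℚ]` odd); the narrow `p`-rank transports `index_range_pow_narrowClassGroup_layer_zero_eq`,
  `index_range_pow_narrowClassGroup_layer_one_eq`.
* §3 **`NarrowFukuda.narrowMu_of_layerOne_model`** — `[K:ℚ]` odd, Fukuda index `0` for every cyclotomic `ℤ₂`-extension (tree:
  `forall_totallyRamifiedFrom_zero_of_not_dvd_discr`, `totallyRamifiedFrom_zero_of_evenIndexCertificate`), a quadratic `L/K` with `θ² = 2` and
  `[Cl⁺(L) : Cl⁺(L)²] = [Cl⁺(K) : Cl⁺(K)²]` ⟹ (a) `μ₂ = 0` for every cyclotomic `ℤ₂`-extension of `K` ∧ (b) `ord₂ h⁺(K_m) ≤ ord₂ h(K_m) + rank₂ Cl⁺(K)` for all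
  layers — Kida-lite's hypotheses from ONE equality between the narrow `2`-ranks of `K(√2)` and `K`; `narrowMu_of_not_dvd_discr_of_layerOne_model`
  (the case `2 ∤ d_K`, fully explicit).

References: [Fukuda1994] Thm. 1 (2), p. 264; [Washington1997] §13.1 (`ℚ_1 = ℚ(√2)`), §13.3; [Kida1982JFields] (μ-part; shape); [FrohlichTaylor1990] Ch. V §1.
-/

set_option autoImplicit false

noncomputable section

open scoped NumberField Polynomial IntermediateField
open NumberField Field Polynomial

namespace Literature.NumberTheory.IwasawaTheory

open Literature.NumberTheory.EllipticCurves Literature.NumberTheory.NumberFields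

variable {K : Type} [Field K] [NumberField K]

/-! ## §1 `X² − 2` over a number field of odd degree -/

/-- There is no rational square root of `2`. [folklore] -/
private theorem rat_sq_ne_two' (q : ℚ) : q ^ 2 ≠ 2 := by
  intro hq
  have h : Real.sqrt 2 = ((|q| : ℚ) : ℝ) := by
    have hq' : ((q : ℝ)) ^ 2 = 2 := by exact_mod_cast hq
    rw [← hq', Real.sqrt_sq_eq_abs, Rat.cast_abs]
  exact irrational_sqrt_two.ne_rat |q| h

/-- **`√2 ∉ K` for a number field `K` of odd degree**: an `x ∈ K` with `x² = 2` is irrational, so `[ℚ(x) : ℚ] = 2` would divide `[K : ℚ]`.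
[cite: Washington1997, §13.1 (`ℚ_1 = ℚ(√2)`; `K ∩ ℚ_∞ = ℚ` for `[K:ℚ]` odd)] -/
theorem sq_ne_two_of_odd_finrank (hodd : Odd (Module.finrank ℚ K)) (x : K) : x ^ 2 ≠ 2 := by
  intro hx
  have hint : IsIntegral ℚ x := Algebra.IsIntegral.isIntegral x
  have haeval : aeval x (X ^ 2 - C (2 : ℚ) : ℚ[X]) = 0 := by
    simp only [map_sub, map_pow, aeval_X, map_ofNat, hx, sub_self]
  have hne : (X ^ 2 - C (2 : ℚ) : ℚ[X]) ≠ 0 := (monic_X_pow_sub_C (2 : ℚ) two_ne_zero).ne_zero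
  have hdeg : (minpoly ℚ x).natDegree ≤ 2 := by
    have h := natDegree_le_natDegree (minpoly.degree_le_of_ne_zero ℚ x hne haeval)
    rwa [natDegree_X_pow_sub_C] at h
  -- `x ∉ ℚ`
  have hnot : x ∉ (algebraMap ℚ K).range := by
    rintro ⟨q, rfl⟩
    have h2 : algebraMap ℚ K (q ^ 2) = algebraMap ℚ K 2 := by rw [map_pow, hx, map_ofNat]
    exact rat_sq_ne_two' q ((algebraMap ℚ K).injective h2)
  have h2le : 2 ≤ (minpoly ℚ x).natDegree := (minpoly.two_le_natDegree_iff hint).mpr hnot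
  have hdeg2 : (minpoly ℚ x).natDegree = 2 := le_antisymm hdeg h2le
  -- `[ℚ(x) : ℚ] = 2 ∣ [K : ℚ]`
  have hfin : Module.finrank ℚ ℚ⟮x⟯ = 2 := by rw [IntermediateField.adjoin.finrank hint, hdeg2]
  have hdvd : 2 ∣ Module.finrank ℚ K := by
    rw [← Module.finrank_mul_finrank ℚ ℚ⟮x⟯ K, hfin]
    exact dvd_mul_right 2 _
  exact (Nat.not_even_iff_odd.mpr hodd) (even_iff_two_dvd.mpr hdvd)

/-- **`X² − 2` is irreducible over a number field of odd degree** (monic quadratic without a root). [cite: Washington1997, §13.1] -/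
theorem irreducible_X_sq_sub_two_of_odd_finrank (hodd : Odd (Module.finrank ℚ K)) :
    Irreducible (X ^ 2 - C (2 : K) : K[X]) := by
  have hmonic : (X ^ 2 - C (2 : K) : K[X]).Monic := monic_X_pow_sub_C (2 : K) two_ne_zero
  have hdeg : (X ^ 2 - C (2 : K) : K[X]).natDegree = 2 := natDegree_X_pow_sub_C
  rw [hmonic.irreducible_iff_roots_eq_zero_of_degree_le_three (by rw [hdeg]) (by rw [hdeg]; norm_num),
    Multiset.eq_zero_iff_forall_notMem]
  intro r hr
  rw [mem_roots hmonic.ne_zero, IsRoot, eval_sub, eval_pow, eval_X, eval_C, sub_eq_zero] at hr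
  exact sq_ne_two_of_odd_finrank hodd r hr

/-- A quadratic extension of an odd-degree number field `K` containing a square root of `2` is `K[X]/(X² − 2)`. [cite: Washington1997, §13.1 (`K_1 = K(√2)`)] -/
private theorem nonempty_algEquiv_adjoinRoot_of_sq_eq_two (hodd : Odd (Module.finrank ℚ K))
    {L : Type*} [Field L] [Algebra K L] [FiniteDimensional K L] (hL : Module.finrank K L = 2) (θ : L) (hθ : θ ^ 2 = 2) :
    Nonempty (AdjoinRoot (X ^ 2 - C (2 : K) : K[X]) ≃ₐ[K] L) := by
  have hirr := irreducible_X_sq_sub_two_of_odd_finrank (K := K) hodd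
  have hmonic : (X ^ 2 - C (2 : K) : K[X]).Monic := monic_X_pow_sub_C (2 : K) two_ne_zero
  have hint : IsIntegral K θ := Algebra.IsIntegral.isIntegral θ
  have haeval : aeval θ (X ^ 2 - C (2 : K) : K[X]) = 0 := by
    simp only [map_sub, map_pow, aeval_X, map_ofNat, hθ, sub_self]
  have hmin : (X ^ 2 - C (2 : K) : K[X]) = minpoly K θ := minpoly.eq_of_irreducible_of_monic hirr haeval hmonic
  have htop : K⟮θ⟯ = ⊤ := by
    apply IntermediateField.eq_of_le_of_finrank_eq le_top
    rw [IntermediateField.adjoin.finrank hint, ← hmin, natDegree_X_pow_sub_C, IntermediateField.finrank_top', hL]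
  exact ⟨(AdjoinRoot.algEquivOfEq K _ _ hmin).trans
    ((IntermediateField.adjoinRootEquivAdjoin K hint).trans ((IntermediateField.equivOfEq htop).trans IntermediateField.topEquiv))⟩

/-- **Two quadratic extensions of an odd-degree number field `K` each containing a square root of `2` are `K`-isomorphic** (both are
`K[X]/(X² − 2)`). [cite: Washington1997, §13.1 (`K_1 = K(√2)`)] -/
theorem nonempty_algEquiv_of_sq_eq_two_of_odd_finrank (hodd : Odd (Module.finrank ℚ K))
    {L₁ L₂ : Type*} [Field L₁] [Algebra K L₁] [FiniteDimensional K L₁] [Field L₂] [Algebra K L₂] [FiniteDimensional K L₂]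
    (h₁ : Module.finrank K L₁ = 2) (θ₁ : L₁) (hθ₁ : θ₁ ^ 2 = 2)
    (h₂ : Module.finrank K L₂ = 2) (θ₂ : L₂) (hθ₂ : θ₂ ^ 2 = 2) : Nonempty (L₁ ≃ₐ[K] L₂) := by
  obtain ⟨e₁⟩ := nonempty_algEquiv_adjoinRoot_of_sq_eq_two hodd h₁ θ₁ hθ₁
  obtain ⟨e₂⟩ := nonempty_algEquiv_adjoinRoot_of_sq_eq_two hodd h₂ θ₂ hθ₂
  exact ⟨e₁.symm.trans e₂⟩

/-! ## §2 Models of the layers `K_0`, `K_1` and the transport of the narrow `p`-rank -/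

/-- **`K_0 ≃ₐ[K] K`** for every `ℤ_p`-extension of a number field (`κ.layer 0 = ⊥`). [cite: Washington1997, §13.1 (the tower `K = K_0 ⊂ K_1 ⊂ ⋯`)] -/
theorem nonempty_algEquiv_layer_zero {p : ℕ} [Fact p.Prime] (κ : ZpExtension K p) : Nonempty (κ.layer 0 ≃ₐ[K] K) :=
  ⟨(IntermediateField.equivOfEq κ.layer_zero).trans (IntermediateField.botEquiv K (AlgebraicClosure K))⟩

/-- **`K_1 ≃ₐ[K] L` for every quadratic `L/K` generated by a square root of `2`**, for every cyclotomic `ℤ₂`-extension `κ` of an odd-degree number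
field `K` (`√2 ∈ K_1` by `exists_sq_eq_two_layer_one_of_not_dvd_finrank`, `[K_1 : K] = 2`, §1). [cite: Washington1997, §13.1 (`ℚ_1 = ℚ(√2)`, `K_n = K·ℚ_n`)] -/
theorem nonempty_algEquiv_layer_one_of_sq_eq_two (hodd : Odd (Module.finrank ℚ K)) (κ : ZpExtension K 2) (hκ : κ.IsCyclotomic)
    (L : Type*) [Field L] [Algebra K L] [FiniteDimensional K L] (hL : Module.finrank K L = 2) (θ : L) (hθ : θ ^ 2 = 2) :
    Nonempty (κ.layer 1 ≃ₐ[K] L) := by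
  haveI : Fact (Nat.Prime 2) := ⟨Nat.prime_two⟩
  have hK : ¬ 2 ∣ Module.finrank ℚ K := fun h => (Nat.not_even_iff_odd.mpr hodd) (even_iff_two_dvd.mpr h)
  obtain ⟨θ₁, hθ₁⟩ := exists_sq_eq_two_layer_one_of_not_dvd_finrank hK κ hκ
  haveI : FiniteDimensional K (κ.layer 1) := κ.finiteDimensional_layer_holds 1
  have h1 : Module.finrank K (κ.layer 1) = 2 := by rw [κ.finrank_layer_holds 1, pow_one]
  exact nonempty_algEquiv_of_sq_eq_two_of_odd_finrank hodd h1 θ₁ hθ₁ hL θ hθ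

/-- **`[Cl⁺(K_0) : Cl⁺(K_0)^q] = [Cl⁺(K) : Cl⁺(K)^q]`** (transport along `K_0 ≅ K`), for any `NumberField` instance on the layer.
[cite: Fukuda1994, Thm. 1 (2), p. 264 (`rank(A_0)`)] [cite: FrohlichTaylor1990, Ch. V §1, p. 163] -/
theorem index_range_pow_narrowClassGroup_layer_zero_eq {p : ℕ} [Fact p.Prime] (κ : ZpExtension K p) (q : ℕ) [NumberField (κ.layer 0)] :
    (powMonoidHom (α := NarrowClassGroup (κ.layer 0)) q).range.index = (powMonoidHom (α := NarrowClassGroup K) q).range.index := by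
  obtain ⟨e⟩ := nonempty_algEquiv_layer_zero κ
  exact index_range_pow_narrowClassGroup_eq_of_ringEquiv e.toRingEquiv q

/-- **`[Cl⁺(K_1) : Cl⁺(K_1)^q] = [Cl⁺(L) : Cl⁺(L)^q]`** for every quadratic `L/K` with a square root of `2` (`[K:ℚ]` odd, `κ` cyclotomic), any `NumberField`
instance on the layer. [cite: Fukuda1994, Thm. 1 (2), p. 264 (`rank(A_1)`)] [cite: Washington1997, §13.1] -/
theorem index_range_pow_narrowClassGroup_layer_one_eq (hodd : Odd (Module.finrank ℚ K)) (κ : ZpExtension K 2) (hκ : κ.IsCyclotomic)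
    (L : Type*) [Field L] [NumberField L] [Algebra K L] (hL : Module.finrank K L = 2) (θ : L) (hθ : θ ^ 2 = 2) (q : ℕ)
    [NumberField (κ.layer 1)] :
    (powMonoidHom (α := NarrowClassGroup (κ.layer 1)) q).range.index = (powMonoidHom (α := NarrowClassGroup L) q).range.index := by
  haveI : FiniteDimensional K L := Module.Finite.of_restrictScalars_finite ℚ K L
  obtain ⟨e⟩ := nonempty_algEquiv_layer_one_of_sq_eq_two hodd κ hκ L hL θ hθ
  exact index_range_pow_narrowClassGroup_eq_of_ringEquiv e.toRingEquiv q

/-! ## §3 The `n₀ = 0` certificate with concrete models: `rank₂ Cl⁺(K(√2)) = rank₂ Cl⁺(K)` -/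

/-- **«NARROW `μ₂ = 0`» OF AN ODD-DEGREE NUMBER FIELD FROM ONE EQUALITY OF NARROW `2`-RANKS.**  Let `K` be a number field of odd degree such that every
cyclotomic `ℤ₂`-extension of `K` has Fukuda index `0` (every prime above `2` ramifies already in `K_1 = K(√2)`; tree criteria
`forall_totallyRamifiedFrom_zero_of_not_dvd_discr` — `2 ∤ d_K` —, `totallyRamifiedFrom_zero_of_evenIndexCertificate`), and let `L/K` be ANY quadratic
extension containing a square root `θ` of `2` (a model of `K(√2)`) with `[Cl⁺(L) : Cl⁺(L)²] = [Cl⁺(K) : Cl⁺(K)²]` (`rank₂ Cl⁺(K(√2)) = rank₂ Cl⁺(K)`).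
Then (a) Iwasawa's `μ₂ = 0` holds for every cyclotomic `ℤ₂`-extension of `K`, and (b) `ord₂ h⁺(K_m) ≤ ord₂ h(K_m) + ord₂ [Cl⁺(K) : Cl⁺(K)²]` for every
cyclotomic `ℤ₂`-extension and every layer — hypotheses `hμ`, `D`, `hδ` of the Kida-lite ascent.  NARROW FUKUDA at `n₀ = n = 0` with the models of §2.
[cite: Fukuda1994, Thm. 1 (2), p. 264] [cite: Washington1997, §13.1] [cite: Kida1982JFields, main theorem (μ-part; shape only)] -/
theorem NarrowFukuda.narrowMu_of_layerOne_model (K : Type) [Field K] [NumberField K] (hodd : Odd (Module.finrank ℚ K))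
    (h0 : ∀ κ : ZpExtension K 2, κ.IsCyclotomic → TotallyRamifiedFrom κ 0)
    (L : Type) [Field L] [NumberField L] [Algebra K L] (hL : Module.finrank K L = 2) (θ : L) (hθ : θ ^ 2 = 2)
    (hr : (powMonoidHom (α := NarrowClassGroup L) 2).range.index = (powMonoidHom (α := NarrowClassGroup K) 2).range.index) :
    (∀ κ : ZpExtension K 2, κ.IsCyclotomic → ClassicalMuVanishes κ) ∧
    (∀ κ : ZpExtension K 2, κ.IsCyclotomic → ∀ m : ℕ, ∀ [NumberField (κ.layer m)],
      padicValNat 2 (narrowClassNumber (κ.layer m)) ≤ padicValNat 2 (classNumber (κ.layer m)) +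
        padicValNat 2 (powMonoidHom (α := NarrowClassGroup K) 2).range.index) := by
  haveI : Fact (Nat.Prime 2) := ⟨Nat.prime_two⟩
  refine NarrowFukuda.narrowMu_of_narrowRankCertificate K 0 (padicValNat 2 (powMonoidHom (α := NarrowClassGroup K) 2).range.index)
    fun κ hκ => ⟨h0 κ hκ, ?_, ?_⟩
  · intro _ _
    exact (index_range_pow_narrowClassGroup_layer_one_eq hodd κ hκ L hL θ hθ 2).trans
      (hr.trans (index_range_pow_narrowClassGroup_layer_zero_eq κ 2).symm)
  · intro m hm _
    obtain rfl : m = 0 := Nat.le_zero.mp hm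
    rw [index_range_pow_narrowClassGroup_layer_zero_eq κ 2]

/-- **The fully explicit case `2 ∤ d_K`** (`2` unramified in the odd-degree field `K`, so Fukuda's index is `0` for every cyclotomic `ℤ₂`-extension by
`forall_totallyRamifiedFrom_zero_of_not_dvd_discr`): a quadratic `L/K` with `θ² = 2` and `rank₂ Cl⁺(L) = rank₂ Cl⁺(K)` gives (a) ∧ (b).
[cite: Fukuda1994, Thm. 1 (2), p. 264] [cite: Washington1997, §13.1 and Prop. 13.2] -/
theorem NarrowFukuda.narrowMu_of_not_dvd_discr_of_layerOne_model (K : Type) [Field K] [NumberField K] (hodd : Odd (Module.finrank ℚ K))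
    (hd : ¬ (2 : ℤ) ∣ NumberField.discr K)
    (L : Type) [Field L] [NumberField L] [Algebra K L] (hL : Module.finrank K L = 2) (θ : L) (hθ : θ ^ 2 = 2)
    (hr : (powMonoidHom (α := NarrowClassGroup L) 2).range.index = (powMonoidHom (α := NarrowClassGroup K) 2).range.index) :
    (∀ κ : ZpExtension K 2, κ.IsCyclotomic → ClassicalMuVanishes κ) ∧
    (∀ κ : ZpExtension K 2, κ.IsCyclotomic → ∀ m : ℕ, ∀ [NumberField (κ.layer m)],
      padicValNat 2 (narrowClassNumber (κ.layer m)) ≤ padicValNat 2 (classNumber (κ.layer m)) +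
        padicValNat 2 (powMonoidHom (α := NarrowClassGroup K) 2).range.index) :=
  NarrowFukuda.narrowMu_of_layerOne_model K hodd
    (forall_totallyRamifiedFrom_zero_of_not_dvd_discr
      (fun h => (Nat.not_even_iff_odd.mpr hodd) (even_iff_two_dvd.mpr h)) hd) L hL θ hθ hr

end Literature.NumberTheory.IwasawaTheory

end
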